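import Literature.Analysis.Complex.ThreeChamberCircles
import Literature.Analysis.Complex.ConformalCurveEndpoints
import HarnessLib

/-!
# The three-chamber lemma (Lawler–Schramm–Werner, proof of Lemma 5.4)

Topic: Analysis / Complex. Fifth and last file of the tree's rendering of the geometric core of
the proof of Lemma 5.4 of G. F. Lawler, O. Schramm, W. Werner, *Conformal invariance of planar
loop-erased random walks and uniform spanning trees*, Ann. Probab. **32** (2004) ("Hence, there
is some `j ∈ {1, 2, 3}` such that `α ∩ K_j = ∅`"). In the axis-aligned normalisation of
`ThreeChamberConfig.lean` (`Setup`: boundary point `0 ∉ Ω`, interior point `x = r + a i`, gates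
`A₁ = (0, x]`, `A₂ = σ[0, τ₊)`, `A₃ = σ(τ₋, 0]` where `σ` runs along `∂Q'`, `Q' = (-r, r)²`,
launch regions `V_m`) we prove:

* **the chamber lemma** (`Setup.exists_near_chamber`): if `ψ(B₀) ⊆ B̄(c, η)` with
  `2^K η ≤ ε < 1`, `K ≥ 400`, `1 - ‖c‖ < ε`, then there is `m` such that every preconnected
  `T ⊆ Ω ∖ G` meeting `V_m` satisfies `‖ψ - c‖ < ε` on `T` — i.e. the whole chamber `K_m` is
  conformally `ε`-close to `x`.

The proof follows [LSW04]: if two different gates met the level set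
`α = {‖ψ - c‖ = ε}` (Case I), a minimal sub-arc `α'` of `α` between two gates and the two gate
pieces would form a Jordan loop in `Ω` through `x`, which `ThreeChamberCircles.caseI_false`
rules out (length–area in place of harmonic measure). Hence at most one gate meets `α`, so two
gates `A_i, A_k` are conformally `ε`-close to `x` (connectedness, `gate_near_of_forall_ne`); their
`ψ`-images are arcs in `B(c, ε) ∩ 𝔻` from `c` with endpoints `e_i, e_k ∈ ∂𝔻` (prime-end type
limits, `CurveEndpoint.exists_endpoint_of_tendsto`), which together with the arc of `∂𝔻`
between `e_i, e_k` inside `B̄(c, ε)` form a Jordan loop `j ⊆ B̄(c, ε)`; by two-sidedness at `c`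
one of the germs `ψ(P_m)`, `ψ(P'_m)` lies inside `j`, hence (propagation along preconnected
sets avoiding `j`) the chamber `K_m`, respectively the chambers `K_i, K_k`, map into
`inside j ⊆ B(c, ε)`.

Everything here is proved.

## References

* G. F. Lawler, O. Schramm, W. Werner, Ann. Probab. 32 (2004), proof of Lemma 5.4.
  [LawlerSchrammWerner2004]
-/

noncomputable section

open Set Filter Metric Function Complex Real
open _root_.Topology
open Literature.Topology.PlaneTopology

namespace Literature.Analysis.Complex

namespace ThreeChamber

/-- The third index of `Fin 3`. [folklore] -/
theorem exists_third {i k : Fin 3} (h : i ≠ k) :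
    ∃ m : Fin 3, m ≠ i ∧ m ≠ k ∧ ∀ l, l = i ∨ l = k ∨ l = m := by
  revert i k; decide

/-- The two other indices of `Fin 3`. [folklore] -/
theorem exists_others (m : Fin 3) : ∃ i k : Fin 3, i ≠ k ∧ i ≠ m ∧ k ≠ m := by
  revert m; decide

/-- **Cosine along a chord of angles**: for `φ, φ' ∈ [-π, π]` and `ξ` between them,
`cos ξ ≥ min (cos φ) (cos φ')`. [folklore] -/
theorem min_cos_le_cos {φ φ' ξ : ℝ} (hφ : |φ| ≤ π) (hφ' : |φ'| ≤ π) (h1 : min φ φ' ≤ ξ)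
    (h2 : ξ ≤ max φ φ') : min (Real.cos φ) (Real.cos φ') ≤ Real.cos ξ := by
  -- `|ξ| ≤ max |φ| |φ'|`
  have hξ : |ξ| ≤ max |φ| |φ'| := by
    rw [abs_le]
    constructor
    · have : -max |φ| |φ'| ≤ min φ φ' := by
        rw [le_min_iff]; constructor
        · linarith [neg_abs_le φ, le_max_left |φ| |φ'|]
        · linarith [neg_abs_le φ', le_max_right |φ| |φ'|]
      linarith
    · have : max φ φ' ≤ max |φ| |φ'| := max_le_max (le_abs_self _) (le_abs_self _)
      linarith
  rw [← Real.cos_abs ξ, ← Real.cos_abs φ, ← Real.cos_abs φ']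
  rcases le_total |φ| |φ'| with h | h
  · rw [max_eq_right h] at hξ
    exact (min_le_right _ _).trans (Real.cos_le_cos_of_nonneg_of_le_pi (abs_nonneg _) hφ' hξ)
  · rw [max_eq_left h] at hξ
    exact (min_le_left _ _).trans (Real.cos_le_cos_of_nonneg_of_le_pi (abs_nonneg _) hφ hξ)

namespace Setup

variable (S : Setup)

/-! ### Endpoints of the gates on `∂𝔻` -/

/-- **The gates have endpoints on `∂𝔻`**: `ψ ∘ A_m → e_m` at `1`, `‖e_m‖ = 1`, `F e_m = A_m 1`.
[folklore] -/
theorem exists_gend (m : Fin 3) : ∃ e : ℂ, ‖e‖ = 1 ∧ S.F e = S.aprEnd m ∧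
    Tendsto (fun t ↦ S.ψ (S.apr m t)) (𝓝[<] 1) (𝓝 e) :=
  CurveEndpoint.exists_endpoint_of_tendsto S.F_cont S.F_diff S.F_maps S.ψ_maps S.ψ_cont S.F_ψ
    (S.continuous_apr m).continuousOn (fun _ ht ↦ S.apr_mem_Ω m ht) (S.aprEnd_notMem m)
    (S.tendsto_apr m)

/-- The endpoint `e_m ∈ ∂𝔻` of gate `m`. [folklore] -/
def gend (m : Fin 3) : ℂ := Classical.choose (S.exists_gend m)

/-- `‖e_m‖ = 1`. [folklore] -/
theorem norm_gend (m : Fin 3) : ‖S.gend m‖ = 1 := (Classical.choose_spec (S.exists_gend m)).1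

/-- `ψ ∘ A_m → e_m`. [folklore] -/
theorem tendsto_gend (m : Fin 3) : Tendsto (fun t ↦ S.ψ (S.apr m t)) (𝓝[<] 1) (𝓝 (S.gend m)) :=
  (Classical.choose_spec (S.exists_gend m)).2.2

/-- **The closed gate arcs in the disc**: `a_m = ψ ∘ A_m` on `[0, 1)`, `a_m 1 = e_m`. [folklore] -/
def garc (m : Fin 3) (t : ℝ) : ℂ := if t < 1 then S.ψ (S.apr m t) else S.gend m

/-- `a_m t = ψ (A_m t)` for `t < 1`. [folklore] -/
theorem garc_of_lt (m : Fin 3) {t : ℝ} (ht : t < 1) : S.garc m t = S.ψ (S.apr m t) := if_pos ht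

/-- `a_m 1 = e_m`. [folklore] -/
theorem garc_one (m : Fin 3) : S.garc m 1 = S.gend m := if_neg (lt_irrefl _)

/-- `a_m 0 = c`. [folklore] -/
theorem garc_zero (m : Fin 3) : S.garc m 0 = S.c := by
  rw [S.garc_of_lt m zero_lt_one, apr_zero]; rfl

/-- `‖a_m t‖ < 1` for `t ∈ [0, 1)`. [folklore] -/
theorem norm_garc_lt (m : Fin 3) {t : ℝ} (ht : t ∈ Ico (0 : ℝ) 1) : ‖S.garc m t‖ < 1 := by
  rw [S.garc_of_lt m ht.2]
  exact mem_ball_zero_iff.1 (S.ψ_maps (S.apr_mem_Ω m ht))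

/-- `a_m` is continuous on `[0, 1]`. [folklore] -/
theorem continuousOn_garc (m : Fin 3) : ContinuousOn (S.garc m) (Icc 0 1) := by
  intro t₀ ht₀
  rcases lt_or_eq_of_le ht₀.2 with h1 | h1
  · -- `t₀ < 1`: locally `ψ ∘ A_m`
    have hca : ContinuousAt (fun t ↦ S.ψ (S.apr m t)) t₀ :=
      (S.ψ_cont.continuousAt (S.isOpen.mem_nhds (S.apr_mem_Ω m ⟨ht₀.1, h1⟩))).comp
        (S.continuous_apr m).continuousAt
    have heq : (fun t ↦ S.ψ (S.apr m t)) =ᶠ[𝓝 t₀] S.garc m := by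
      filter_upwards [Iio_mem_nhds h1] with t ht
      exact (S.garc_of_lt m ht).symm
    exact (hca.congr heq).continuousWithinAt
  · -- `t₀ = 1`: the limit `e_m`
    subst h1
    have h : ContinuousWithinAt (S.garc m) (Iio 1) 1 := by
      have : Tendsto (S.garc m) (𝓝[<] 1) (𝓝 (S.gend m)) := by
        refine (S.tendsto_gend m).congr' ?_
        filter_upwards [self_mem_nhdsWithin] with t ht
        exact (S.garc_of_lt m ht).symm
      rw [ContinuousWithinAt, garc_one]; exact this
    exact (continuousWithinAt_Iio_iff_Iic.1 h).mono Icc_subset_Iic_self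

/-- `a_m` is injective on `[0, 1]`. [folklore] -/
theorem injOn_garc (m : Fin 3) : InjOn (S.garc m) (Icc 0 1) := by
  intro s hs t ht hst
  rcases lt_or_eq_of_le hs.2 with hs1 | hs1 <;> rcases lt_or_eq_of_le ht.2 with ht1 | ht1
  · rw [S.garc_of_lt m hs1, S.garc_of_lt m ht1] at hst
    exact S.injOn_apr m ⟨hs.1, hs1⟩ ⟨ht.1, ht1⟩
      (S.ψ_injOn (S.apr_mem_Ω m ⟨hs.1, hs1⟩) (S.apr_mem_Ω m ⟨ht.1, ht1⟩) hst)
  · exfalso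
    have h1 := S.norm_garc_lt m ⟨hs.1, hs1⟩
    rw [hst, ht1, garc_one, norm_gend] at h1
    exact lt_irrefl _ h1
  · exfalso
    have h1 := S.norm_garc_lt m ⟨ht.1, ht1⟩
    rw [← hst, hs1, garc_one, norm_gend] at h1
    exact lt_irrefl _ h1
  · rw [hs1, ht1]

/-- The trace of `a_m`: `ψ(gate m) ∪ {e_m}`. [folklore] -/
theorem image_garc (m : Fin 3) : S.garc m '' Icc 0 1 = S.ψ '' S.gate m ∪ {S.gend m} := by
  ext w
  constructor
  · rintro ⟨t, ht, rfl⟩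
    rcases lt_or_eq_of_le ht.2 with h1 | h1
    · left; rw [S.garc_of_lt m h1]; exact ⟨_, S.apr_mem_gate m ⟨ht.1, h1⟩, rfl⟩
    · right; rw [h1, garc_one]; rfl
  · rintro (⟨z, hz, rfl⟩ | hw)
    · obtain ⟨t, ht, rfl⟩ := S.exists_apr_eq m hz
      exact ⟨t, Ico_subset_Icc_self ht, S.garc_of_lt m ht.2⟩
    · rw [mem_singleton_iff] at hw
      exact ⟨1, right_mem_Icc.2 zero_le_one, by rw [hw, garc_one]⟩

/-- Points of the trace of `a_m` in the open disc are in `ψ(gate m)`. [folklore] -/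
theorem mem_image_gate_of_mem_image_garc (m : Fin 3) {w : ℂ} (hw : w ∈ S.garc m '' Icc 0 1)
    (hw1 : ‖w‖ < 1) : w ∈ S.ψ '' S.gate m := by
  rw [image_garc] at hw
  rcases hw with h | h
  · exact h
  · rw [mem_singleton_iff] at h; rw [h, norm_gend] at hw1; exact absurd hw1 (lt_irrefl _)

/-- The trace of `a_m` lies in `B̄(c, ε)` when gate `m` is conformally `ε`-close. [folklore] -/
theorem image_garc_subset (m : Fin 3) {ε : ℝ} (hnear : ∀ z ∈ S.gate m, ‖S.ψ z - S.c‖ < ε) :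
    S.garc m '' Icc 0 1 ⊆ closedBall S.c ε := by
  rw [image_garc]
  rintro w (⟨z, hz, rfl⟩ | hw)
  · exact mem_closedBall.2 (by rw [dist_eq_norm]; exact (hnear z hz).le)
  · rw [mem_singleton_iff] at hw
    rw [hw]
    refine isClosed_closedBall.mem_of_tendsto (S.tendsto_gend m) ?_
    filter_upwards [Ico_mem_nhdsLT zero_lt_one] with t ht
    exact mem_closedBall.2 (by rw [dist_eq_norm]; exact (hnear _ (S.apr_mem_gate m ht)).le)

/-- The traces of two gate arcs meet only at `c` and possibly at a common endpoint. [folklore] -/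
theorem image_garc_inter {i k : Fin 3} (hik : i ≠ k) :
    S.garc i '' Icc 0 1 ∩ S.garc k '' Icc 0 1 ⊆ {S.c, S.gend i} := by
  rintro w ⟨hwi, hwk⟩
  rw [image_garc] at hwi hwk
  rcases hwi with ⟨a, ha, rfl⟩ | hwi
  · rcases hwk with ⟨b, hb, hab⟩ | hwk
    · left
      have : b = a := S.ψ_injOn (S.gate_subset_Ω k hb) (S.gate_subset_Ω i ha) hab
      subst this
      have hx : b = S.x := S.gate_inter_gate_subset hik ⟨ha, hb⟩
      rw [hx]; rfl
    · exfalso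
      rw [mem_singleton_iff] at hwk
      have h1 := mem_ball_zero_iff.1 (S.ψ_maps (S.gate_subset_Ω i ha))
      rw [hwk, norm_gend] at h1
      exact lt_irrefl _ h1
  · right; exact hwi

/-! ### The arc of `∂𝔻` inside `B̄(c, ε)` -/

/-- The angle of a point of `∂𝔻` relative to `c`: `e = e^{i(arg c + φ)}`, `φ ∈ (-π, π]`. [folklore] -/
def relAngle (e : ℂ) : ℝ := arg (e * exp (-(arg S.c * I)))

/-- `|φ_e| ≤ π`. [folklore] -/
theorem abs_relAngle_le (e : ℂ) : |S.relAngle e| ≤ π := abs_arg_le_pi _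

/-- `e = e^{i(arg c + φ_e)}` for `‖e‖ = 1`. [folklore] -/
theorem circleMap_relAngle {e : ℂ} (he : ‖e‖ = 1) : circleMap 0 1 (arg S.c + S.relAngle e) = e := by
  have h1 : ‖e * exp (-(arg S.c * I))‖ = 1 := by
    rw [norm_mul, he, one_mul, show -(↑(arg S.c) * I) = ↑(-arg S.c) * I by push_cast; ring,
      norm_exp_ofReal_mul_I]
  have h2 := norm_mul_exp_arg_mul_I (e * exp (-(arg S.c * I)))
  rw [h1, ofReal_one, one_mul] at h2
  rw [circleMap, zero_add, ofReal_one, one_mul, relAngle]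
  calc exp (↑(arg S.c + arg (e * exp (-(↑(arg S.c) * I)))) * I)
      = exp (arg S.c * I) * exp (↑(arg (e * exp (-(↑(arg S.c) * I)))) * I) := by
        rw [← Complex.exp_add]; push_cast; ring_nf
    _ = exp (arg S.c * I) * (e * exp (-(arg S.c * I))) := by rw [h2]
    _ = e := by
        rw [mul_comm, mul_assoc, ← Complex.exp_add, neg_add_cancel, Complex.exp_zero, mul_one]

/-- `‖e^{i(arg c + φ)} - c‖² = 1 + ‖c‖² - 2 ‖c‖ cos φ`. [folklore] -/
theorem norm_sq_circleMap_sub_c (φ : ℝ) :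
    ‖circleMap 0 1 (arg S.c + φ) - S.c‖ ^ 2 = 1 + ‖S.c‖ ^ 2 - 2 * ‖S.c‖ * Real.cos φ := by
  have hc : exp (arg S.c * I) * (‖S.c‖ : ℂ) = S.c := by rw [mul_comm]; exact norm_mul_exp_arg_mul_I S.c
  have h1 : circleMap 0 1 (arg S.c + φ) - S.c = exp (arg S.c * I) * (exp (φ * I) - ‖S.c‖) := by
    rw [mul_sub, ← Complex.exp_add, hc, circleMap, zero_add, ofReal_one, one_mul]
    congr 1; push_cast; ring_nf
  rw [h1, norm_mul, norm_exp_ofReal_mul_I, one_mul, Complex.sq_norm, Complex.normSq_apply]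
  simp only [sub_re, exp_ofReal_mul_I_re, ofReal_re, sub_im, exp_ofReal_mul_I_im, ofReal_im,
    sub_zero]
  nlinarith [Real.sin_sq_add_cos_sq φ]

/-- **Characterisation of `∂𝔻 ∩ B̄(c, ε)` by angles**: `‖e^{i(arg c + φ)} - c‖ ≤ ε` iff
`1 + ‖c‖² - ε² ≤ 2 ‖c‖ cos φ`. [folklore] -/
theorem norm_circleMap_sub_c_le_iff (φ : ℝ) {ε : ℝ} (hε : 0 ≤ ε) :
    ‖circleMap 0 1 (arg S.c + φ) - S.c‖ ≤ ε ↔ 1 + ‖S.c‖ ^ 2 - ε ^ 2 ≤ 2 * ‖S.c‖ * Real.cos φ := by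
  rw [← sq_le_sq₀ (norm_nonneg _) hε, norm_sq_circleMap_sub_c]
  constructor <;> intro h <;> linarith

/-- **The arc of `∂𝔻` between two points of `∂𝔻 ∩ B̄(c, ε)` stays in `B̄(c, ε)`.** [folklore] -/
theorem circleMap_interp_mem {e e' : ℂ} (he : ‖e‖ = 1) (he' : ‖e'‖ = 1) {ε : ℝ} (hε : 0 ≤ ε)
    (hec : ‖e - S.c‖ ≤ ε) (he'c : ‖e' - S.c‖ ≤ ε) {s : ℝ} (hs : s ∈ Icc (0 : ℝ) 1) :
    circleMap 0 1 (arg S.c + ((1 - s) * S.relAngle e + s * S.relAngle e')) ∈ closedBall S.c ε := by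
  rw [mem_closedBall, dist_eq_norm, S.norm_circleMap_sub_c_le_iff _ hε]
  rw [← S.circleMap_relAngle he, S.norm_circleMap_sub_c_le_iff _ hε] at hec
  rw [← S.circleMap_relAngle he', S.norm_circleMap_sub_c_le_iff _ hε] at he'c
  have hmin := min_cos_le_cos (S.abs_relAngle_le e) (S.abs_relAngle_le e')
    (ξ := (1 - s) * S.relAngle e + s * S.relAngle e') ?_ ?_
  · have hc0 : 0 ≤ 2 * ‖S.c‖ := by positivity
    calc 1 + ‖S.c‖ ^ 2 - ε ^ 2 ≤ 2 * ‖S.c‖ * min (Real.cos (S.relAngle e)) (Real.cos (S.relAngle e')) := by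
          rcases min_choice (Real.cos (S.relAngle e)) (Real.cos (S.relAngle e')) with h | h <;>
            rw [h] <;> assumption
      _ ≤ 2 * ‖S.c‖ * Real.cos ((1 - s) * S.relAngle e + s * S.relAngle e') :=
          mul_le_mul_of_nonneg_left hmin hc0
  · rcases le_total (S.relAngle e) (S.relAngle e') with h | h
    · rw [min_eq_left h]; nlinarith [hs.1, hs.2]
    · rw [min_eq_right h]; nlinarith [hs.1, hs.2]
  · rcases le_total (S.relAngle e) (S.relAngle e') with h | h
    · rw [max_eq_right h]; nlinarith [hs.1, hs.2]
    · rw [max_eq_left h]; nlinarith [hs.1, hs.2]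

/-! ### Case II: the loop through two near gates -/

/-- **The Jordan loop through two conformally close gates.** For gates `i ≠ k` there is a
Jordan loop `j` through `c` whose points in the open disc are `ψ`-images of points of the two
gates, and which lies in `B̄(c, ε)` as soon as both gates are conformally `ε`-close to `x`
(`j = a_i ∪ (arc of ∂𝔻 from e_i to e_k in B̄(c, ε)) ∪ a_k`, or `a_i ∪ a_k` if `e_i = e_k`).
[cite: LawlerSchrammWerner2004, proof of Lemma 5.4] -/
theorem exists_loop {i k : Fin 3} (hik : i ≠ k) {ε : ℝ} (hε : 0 < ε)
    (hni : ∀ z ∈ S.gate i, ‖S.ψ z - S.c‖ < ε) (hnk : ∀ z ∈ S.gate k, ‖S.ψ z - S.c‖ < ε) :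
    ∃ j : ℝ → ℂ, IsJordanLoop j ∧ S.c ∈ range j ∧ range j ⊆ closedBall S.c ε ∧
      ∀ w ∈ range j, ‖w‖ < 1 → w ∈ S.ψ '' (S.gate i ∪ S.gate k) := by
  have hgi := S.image_garc_subset i hni
  have hgk := S.image_garc_subset k hnk
  have hei : ‖S.gend i - S.c‖ ≤ ε := by
    have := hgi ⟨1, right_mem_Icc.2 zero_le_one, S.garc_one i⟩
    rwa [mem_closedBall, dist_eq_norm] at this
  have hek : ‖S.gend k - S.c‖ ≤ ε := by
    have := hgk ⟨1, right_mem_Icc.2 zero_le_one, S.garc_one k⟩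
    rwa [mem_closedBall, dist_eq_norm] at this
  -- points of the disc on the gate arcs
  have hdisc : ∀ w, w ∈ S.garc i '' Icc 0 1 ∪ S.garc k '' Icc 0 1 → ‖w‖ < 1 →
      w ∈ S.ψ '' (S.gate i ∪ S.gate k) := by
    rintro w (hw | hw) hw1
    · rw [image_union]; exact Or.inl (S.mem_image_gate_of_mem_image_garc i hw hw1)
    · rw [image_union]; exact Or.inr (S.mem_image_gate_of_mem_image_garc k hw hw1)
  by_cases heq : S.gend i = S.gend k
  · -- degenerate case: `a_i ∪ a_k`
    obtain ⟨hJ, hrange⟩ := isJordanLoop_biLoop (S.continuousOn_garc i) (S.continuousOn_garc k)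
      (S.injOn_garc i) (S.injOn_garc k) (by rw [garc_zero, garc_zero])
      (by rw [garc_one, garc_one, heq]) (by rw [garc_zero, garc_one]; exact S.image_garc_inter hik)
    refine ⟨_, hJ, ?_, ?_, ?_⟩
    · rw [hrange]; exact Or.inl ⟨0, left_mem_Icc.2 zero_le_one, S.garc_zero i⟩
    · rw [hrange]; exact union_subset hgi hgk
    · rw [hrange]; exact hdisc
  · -- the arc of `∂𝔻` from `e_i` to `e_k`
    set β : ℝ → ℂ := fun s ↦ circleMap 0 1 (arg S.c + ((1 - s) * S.relAngle (S.gend i) +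
      s * S.relAngle (S.gend k))) with hβ
    have hβc : ContinuousOn β (Icc 0 1) := by
      rw [hβ]; exact ((continuous_circleMap 0 1).comp (by fun_prop)).continuousOn
    have hne : S.relAngle (S.gend i) ≠ S.relAngle (S.gend k) := fun h ↦ heq (by
      rw [← S.circleMap_relAngle (S.norm_gend i), ← S.circleMap_relAngle (S.norm_gend k), h])
    have hβi : InjOn β (Icc 0 1) := by
      intro s hs t ht hst
      set φi := S.relAngle (S.gend i)
      set φk := S.relAngle (S.gend k)
      have hlen : max φi φk - min φi φk < 2 * π := by
        have a1 : -π < φi := neg_pi_lt_arg _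
        have a2 : φi ≤ π := arg_le_pi _
        have b1 : -π < φk := neg_pi_lt_arg _
        have b2 : φk ≤ π := arg_le_pi _
        rcases le_total φi φk with h | h
        · rw [max_eq_right h, min_eq_left h]; linarith
        · rw [max_eq_left h, min_eq_right h]; linarith
      have hmem : ∀ u ∈ Icc (0 : ℝ) 1, (1 - u) * φi + u * φk ∈ Icc (min φi φk) (max φi φk) := by
        intro u hu
        rcases le_total φi φk with h | h
        · rw [min_eq_left h, max_eq_right h]; constructor <;> nlinarith [hu.1, hu.2]
        · rw [min_eq_right h, max_eq_left h]; constructor <;> nlinarith [hu.1, hu.2]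
      have key := injOn_circleMap_of_lt (c' := 0) one_ne_zero (p := arg S.c + min φi φk)
        (q := arg S.c + max φi φk) (by linarith)
        ⟨by linarith [(hmem s hs).1], by linarith [(hmem s hs).2]⟩
        ⟨by linarith [(hmem t ht).1], by linarith [(hmem t ht).2]⟩ hst
      have : (s - t) * (φk - φi) = 0 := by linarith
      rcases mul_eq_zero.1 this with h | h
      · linarith
      · exact absurd (by linarith : φi = φk) hne
    have hβ0 : β 0 = S.gend i := by
      simp only [hβ]; rw [show (1 - 0 : ℝ) * S.relAngle (S.gend i) + 0 * S.relAngle (S.gend k) =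
        S.relAngle (S.gend i) by ring]; exact S.circleMap_relAngle (S.norm_gend i)
    have hβ1 : β 1 = S.gend k := by
      simp only [hβ]; rw [show (1 - 1 : ℝ) * S.relAngle (S.gend i) + 1 * S.relAngle (S.gend k) =
        S.relAngle (S.gend k) by ring]; exact S.circleMap_relAngle (S.norm_gend k)
    have hβnorm : ∀ s, ‖β s‖ = 1 := fun s ↦ by
      simp only [hβ]; rw [norm_circleMap_zero, abs_one]
    have hβmem : β '' Icc 0 1 ⊆ closedBall S.c ε := by
      rintro w ⟨s, hs, rfl⟩
      exact S.circleMap_interp_mem (S.norm_gend i) (S.norm_gend k) hε.le hei hek hs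
    -- a gate arc meets `β` only at its endpoint
    have hmeet : ∀ m : Fin 3, S.garc m '' Icc 0 1 ∩ β '' Icc 0 1 ⊆ {S.gend m} := by
      rintro m w ⟨hw, ⟨s, -, rfl⟩⟩
      rw [image_garc] at hw
      rcases hw with ⟨z, hz, hzw⟩ | hw
      · exfalso
        have h1 := mem_ball_zero_iff.1 (S.ψ_maps (S.gate_subset_Ω m hz))
        rw [hzw, hβnorm] at h1
        exact lt_irrefl _ h1
      · exact hw
    have hA : S.garc i '' Icc 0 1 ∩ S.garc k '' Icc 0 1 ⊆ {S.garc i 0} := by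
      -- `a_i ∩ a_k ⊆ {c}`
      rintro w hw
      rcases S.image_garc_inter hik hw with h | h
      · rw [h, garc_zero]; rfl
      · exfalso
        -- `e_i` on `a_k` is `e_k`
        have hw2 : S.gend i ∈ S.garc k '' Icc 0 1 := h ▸ hw.2
        rw [image_garc] at hw2
        rcases hw2 with ⟨z, hz, hzw⟩ | hw2
        · have h1 := mem_ball_zero_iff.1 (S.ψ_maps (S.gate_subset_Ω k hz))
          rw [hzw, norm_gend] at h1
          exact lt_irrefl _ h1
        · exact heq hw2
    have hB : S.garc i '' Icc 0 1 ∩ β '' Icc 0 1 ⊆ {S.garc i 1} := by rw [garc_one]; exact hmeet i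
    have hC : S.garc k '' Icc 0 1 ∩ β '' Icc 0 1 ⊆ {S.garc k 1} := by rw [garc_one]; exact hmeet k
    obtain ⟨hJ, hrange⟩ := isJordanLoop_triLoop (S.continuousOn_garc i) (S.continuousOn_garc k)
      hβc (S.injOn_garc i) (S.injOn_garc k) hβi (by rw [garc_zero, garc_zero])
      (by rw [hβ0, garc_one]) (by rw [hβ1, garc_one]) hA hB hC
    refine ⟨_, hJ, ?_, ?_, ?_⟩
    · rw [hrange]; exact Or.inl (Or.inl ⟨0, left_mem_Icc.2 zero_le_one, S.garc_zero i⟩)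
    · rw [hrange]; exact union_subset (union_subset hgi hβmem) hgk
    · rw [hrange]
      rintro w ((hw | ⟨s, -, rfl⟩) | hw) hw1
      · exact hdisc w (Or.inl hw) hw1
      · rw [hβnorm] at hw1; exact absurd hw1 (lt_irrefl _)
      · exact hdisc w (Or.inr hw) hw1

/-- **Case II of the chamber lemma.** If the two gates other than `m` are conformally
`ε`-close to `x`, then some chamber is: either `K_m` (if the germ `P_m` maps inside the loop
`j` of `exists_loop`) or both other chambers (if `P'_m` does).
[cite: LawlerSchrammWerner2004, proof of Lemma 5.4] -/
theorem caseII {ε : ℝ} (hε : 0 < ε) {m i k : Fin 3} (hik : i ≠ k) (him : i ≠ m) (hkm : k ≠ m)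
    (hni : ∀ z ∈ S.gate i, ‖S.ψ z - S.c‖ < ε) (hnk : ∀ z ∈ S.gate k, ‖S.ψ z - S.c‖ < ε) :
    ∃ l : Fin 3, ∀ T : Set ℂ, IsPreconnected T → T ⊆ S.Ω → Disjoint T S.G →
      (T ∩ S.V l).Nonempty → ∀ z ∈ T, ‖S.ψ z - S.c‖ < ε := by
  obtain ⟨j, hj, hc, hjε, hjdisc⟩ := S.exists_loop hik hε hni hnk
  have hins : IsJordanLoop.inside j ⊆ ball S.c ε := hj.inside_subset_ball hjε
  -- points of `Ω` mapped onto `j` are on the two gates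
  have hback : ∀ z ∈ S.Ω, S.ψ z ∈ range j → z ∈ S.gate i ∪ S.gate k := by
    intro z hz hzj
    obtain ⟨w, hw, hwz⟩ := hjdisc _ hzj (mem_ball_zero_iff.1 (S.ψ_maps hz))
    have hwΩ : w ∈ S.Ω := hw.elim (fun h ↦ S.gate_subset_Ω i h) (fun h ↦ S.gate_subset_Ω k h)
    rwa [← S.ψ_injOn hwΩ hz hwz]
  have hloc : ∀ z ∈ ball S.x S.rho, z ∈ S.Ω → S.ψ z ∈ range j → ∃ i', i' ≠ m ∧ z ∈ S.gate i' := by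
    intro z _ hzΩ hzj
    rcases hback z hzΩ hzj with h | h
    · exact ⟨i, him, h⟩
    · exact ⟨k, hkm, h⟩
  have hG : ∀ z ∈ S.Ω, z ∉ S.G → S.ψ z ∉ range j := fun z hz hzG hzj ↦
    (hback z hz hzj).elim (fun h ↦ hzG (S.gate_subset_G i h)) (fun h ↦ hzG (S.gate_subset_G k h))
  have hV : ∀ l, ∀ z ∈ S.V l, S.ψ z ∉ range j := fun l z hz ↦
    hG z (S.B₀_subset (S.V_subset_B₀ l hz)) (Set.disjoint_left.1 (S.disjoint_V_G l) hz)
  have hconc : ∀ T : Set ℂ, T ⊆ S.Ω → S.ψ '' T ⊆ IsJordanLoop.inside j →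
      ∀ z ∈ T, ‖S.ψ z - S.c‖ < ε := fun T _ hT z hz ↦ by
    have := hins (hT ⟨z, hz, rfl⟩)
    rwa [mem_ball, dist_eq_norm] at this
  rcases S.two_sided hj hc m hloc S.rho_pos le_rfl with ⟨hP, -⟩ | ⟨-, hP'⟩
  · refine ⟨m, fun T hT hTΩ hTG hTV ↦ hconc T hTΩ ?_⟩
    exact S.image_subset_inside_of_germ hj S.rho_pos hP (hV m) hT hTΩ
      (fun z hz ↦ hG z (hTΩ hz) (Set.disjoint_left.1 hTG hz)) hTV
  · refine ⟨i, fun T hT hTΩ hTG hTV ↦ hconc T hTΩ ?_⟩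
    exact S.image_subset_inside_of_germ' hj him S.rho_pos hP' (hV i) hT hTΩ
      (fun z hz ↦ hG z (hTΩ hz) (Set.disjoint_left.1 hTG hz)) hTV

/-! ### Case I: the loop through a clean level sub-arc -/

section CaseI

variable {ε : ℝ} (hε0 : 0 < ε) (hε1 : ε < 1) (hcε : 1 - ‖S.c‖ < ε)
include hε0 hε1 hcε

/-- **The Case I loop.** If parameters `s < t` of the level crosscut `α` lie on different gates
`i ≠ k`, then (after passing to a clean sub-arc) the two gate pieces and the level sub-arc form
a Jordan loop `J ⊆ Ω` through `x` as in `caseI_false`. [cite: LawlerSchrammWerner2004, proof of Lemma 5.4] -/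
theorem exists_caseI_loop {i k : Fin 3} (hik : i ≠ k) {s t : ℝ} (hst : s < t)
    (hs : s ∈ Ioo (S.levelLo ε) (S.levelHi ε)) (ht : t ∈ Ioo (S.levelLo ε) (S.levelHi ε))
    (hsi : S.levelArc ε s ∈ S.gate i) (htk : S.levelArc ε t ∈ S.gate k) :
    ∃ m : Fin 3, ∃ J : ℝ → ℂ, IsJordanLoop J ∧ range J ⊆ S.Ω ∧ S.x ∈ range J ∧
      ∀ z ∈ range J, (∃ i', i' ≠ m ∧ z ∈ S.gate i') ∨ (‖S.ψ z - S.c‖ = ε ∧ ∀ i', z ∉ S.gateC i') := by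
  have hαmem := fun θ (hθ : θ ∈ Ioo (S.levelLo ε) (S.levelHi ε)) ↦ S.levelArc_mem hε0 hε1 hcε hθ
  have hαx := fun θ (hθ : θ ∈ Ioo (S.levelLo ε) (S.levelHi ε)) ↦ S.levelArc_ne_x hε0 hε1 hcε hθ
  -- gate membership of level points: closed gate ∩ Ω
  have hgate : ∀ m θ, θ ∈ Ioo (S.levelLo ε) (S.levelHi ε) → (S.levelArc ε θ ∈ S.gate m ↔ S.levelArc ε θ ∈ S.gateC m) := by
    intro m θ hθ; rw [S.gate_eq m]; exact ⟨fun h ↦ h.1, fun h ↦ ⟨h, (hαmem θ hθ).1⟩⟩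
  have hdisj : ∀ m m' : Fin 3, m ≠ m' → ∀ θ ∈ Ioo (S.levelLo ε) (S.levelHi ε),
      S.levelArc ε θ ∈ S.gateC m → S.levelArc ε θ ∉ S.gateC m' := by
    intro m m' hmm' θ hθ h1 h2
    rw [← hgate m θ hθ] at h1
    rw [← hgate m' θ hθ] at h2
    exact hαx θ hθ (S.gate_inter_gate_subset hmm' ⟨h1, h2⟩)
  obtain ⟨s', t', hss', hs't', ht't, i', k', hik', hs'i, ht'k, hclean⟩ :=
    exists_clean_subinterval (S.continuousOn_levelArc hε0 hε1 hcε) S.gateC S.isClosed_gateC hdisj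
      hst hs ht hik ((hgate i s hs).1 hsi) ((hgate k t ht).1 htk)
  have hs' : s' ∈ Ioo (S.levelLo ε) (S.levelHi ε) := ⟨hs.1.trans_le hss', hs't'.trans (ht't.trans_lt ht.2)⟩
  have ht' : t' ∈ Ioo (S.levelLo ε) (S.levelHi ε) := ⟨hs'.1.trans hs't', ht't.trans_lt ht.2⟩
  have hP : S.levelArc ε s' ∈ S.gate i' := (hgate i' s' hs').2 hs'i
  have hQ : S.levelArc ε t' ∈ S.gate k' := (hgate k' t' ht').2 ht'k
  obtain ⟨m, hmi, hmk, hall⟩ := exists_third hik'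
  -- gate pieces via the approach paths
  obtain ⟨sP, hsP, hsPeq⟩ := S.exists_apr_eq i' hP
  obtain ⟨sQ, hsQ, hsQeq⟩ := S.exists_apr_eq k' hQ
  have hsP0 : sP ≠ 0 := fun h ↦ hαx s' hs' (by rw [← hsPeq, h, apr_zero])
  have hsQ0 : sQ ≠ 0 := fun h ↦ hαx t' ht' (by rw [← hsQeq, h, apr_zero])
  set g₁ : ℝ → ℂ := fun u ↦ S.apr i' (u * sP) with hg₁
  set g₂ : ℝ → ℂ := fun u ↦ S.apr k' (u * sQ) with hg₂
  set β : ℝ → ℂ := fun u ↦ S.levelArc ε (s' + u * (t' - s')) with hβ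
  have hmul : ∀ {u s₀ : ℝ}, u ∈ Icc (0 : ℝ) 1 → s₀ ∈ Ico (0 : ℝ) 1 → u * s₀ ∈ Ico (0 : ℝ) 1 :=
    fun hu hs₀ ↦ ⟨mul_nonneg hu.1 hs₀.1, by nlinarith [hu.2, hs₀.2, hs₀.1]⟩
  have hpar : ∀ u ∈ Icc (0 : ℝ) 1, s' + u * (t' - s') ∈ Icc s' t' := fun u hu ↦
    ⟨by nlinarith [hu.1], by nlinarith [hu.2]⟩
  have hparI : ∀ u ∈ Icc (0 : ℝ) 1, s' + u * (t' - s') ∈ Ioo (S.levelLo ε) (S.levelHi ε) :=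
    fun u hu ↦ ⟨hs'.1.trans_le (hpar u hu).1, (hpar u hu).2.trans_lt ht'.2⟩
  -- traces
  have hg₁im : g₁ '' Icc 0 1 ⊆ S.gate i' := by
    rintro z ⟨u, hu, rfl⟩; exact S.apr_mem_gate i' (hmul hu hsP)
  have hg₂im : g₂ '' Icc 0 1 ⊆ S.gate k' := by
    rintro z ⟨u, hu, rfl⟩; exact S.apr_mem_gate k' (hmul hu hsQ)
  -- the level sub-arc: endpoints on the gates, interior clean and far
  have hβpt : ∀ u ∈ Icc (0 : ℝ) 1, β u = S.levelArc ε s' ∨ β u = S.levelArc ε t' ∨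
      (‖S.ψ (β u) - S.c‖ = ε ∧ ∀ l, β u ∉ S.gateC l) := by
    intro u hu
    rcases eq_or_lt_of_le hu.1 with h0 | h0
    · left; simp [hβ, ← h0]
    rcases eq_or_lt_of_le hu.2 with h1 | h1
    · right; left; simp [hβ, h1]
    right; right
    have hIoo : s' + u * (t' - s') ∈ Ioo s' t' := ⟨by nlinarith, by nlinarith⟩
    exact ⟨(hαmem _ (hparI u hu)).2.2, hclean _ hIoo⟩
  have h12 : g₁ '' Icc 0 1 ∩ g₂ '' Icc 0 1 ⊆ {g₁ 0} := by
    -- `g₁ ∩ g₂ ⊆ {x}`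
    rintro z ⟨hz1, hz2⟩
    have := S.gate_inter_gate_subset hik' ⟨hg₁im hz1, hg₂im hz2⟩
    rw [mem_singleton_iff] at this ⊢
    rw [this]; simp [hg₁, apr_zero]
  have h1β : g₁ '' Icc 0 1 ∩ β '' Icc 0 1 ⊆ {g₁ 1} := by
    -- `g₁ ∩ β ⊆ {g₁ 1}`
    rintro z ⟨hz1, ⟨u, hu, rfl⟩⟩
    rw [mem_singleton_iff]
    rcases hβpt u hu with h | h | ⟨-, h⟩
    · rw [h]; simp [hg₁, hsPeq]
    · exfalso
      have h1 : S.levelArc ε t' ∈ S.gate i' := h ▸ hg₁im hz1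
      exact hαx t' ht' (S.gate_inter_gate_subset hik' ⟨h1, hQ⟩)
    · exfalso
      exact h i' ((hgate i' _ (hparI u hu)).1 (hg₁im hz1))
  have h2β : g₂ '' Icc 0 1 ∩ β '' Icc 0 1 ⊆ {g₂ 1} := by
    -- `g₂ ∩ β ⊆ {g₂ 1}`
    rintro z ⟨hz2, ⟨u, hu, rfl⟩⟩
    rw [mem_singleton_iff]
    rcases hβpt u hu with h | h | ⟨-, h⟩
    · exfalso
      have h1 : S.levelArc ε s' ∈ S.gate k' := h ▸ hg₂im hz2
      exact hαx s' hs' (S.gate_inter_gate_subset hik' ⟨hP, h1⟩)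
    · rw [h]; simp [hg₂, hsQeq]
    · exfalso
      exact h k' ((hgate k' _ (hparI u hu)).1 (hg₂im hz2))
  obtain ⟨hJ, hrange⟩ := isJordanLoop_triLoop (g₁ := g₁) (g₂ := g₂) (β := β)
    (((S.continuous_apr i').comp (continuous_id.mul continuous_const)).continuousOn)
    (((S.continuous_apr k').comp (continuous_id.mul continuous_const)).continuousOn)
    ((S.continuousOn_levelArc hε0 hε1 hcε).comp (by fun_prop) hparI)
    (fun u hu v hv huv ↦ by
      have := S.injOn_apr i' (hmul hu hsP) (hmul hv hsP) huv
      exact mul_right_cancel₀ hsP0 this)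
    (fun u hu v hv huv ↦ by
      have := S.injOn_apr k' (hmul hu hsQ) (hmul hv hsQ) huv
      exact mul_right_cancel₀ hsQ0 this)
    (fun u hu v hv huv ↦ by
      have := S.injOn_levelArc hε0 hε1 hcε (hparI u hu) (hparI v hv) huv
      have h2 : (u - v) * (t' - s') = 0 := by linarith
      rcases mul_eq_zero.1 h2 with h | h
      · linarith
      · linarith)
    (by simp [hg₁, hg₂, apr_zero])
    (by simp [hβ, hg₁, hsPeq])
    (by simp [hβ, hg₂, hsQeq])
    h12 h1β h2β
  refine ⟨m, _, hJ, ?_, ?_, ?_⟩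
  · rw [hrange]
    refine union_subset (union_subset (hg₁im.trans (S.gate_subset_Ω i')) ?_)
      (hg₂im.trans (S.gate_subset_Ω k'))
    rintro z ⟨u, hu, rfl⟩; exact (hαmem _ (hparI u hu)).1
  · rw [hrange]
    exact Or.inl (Or.inl ⟨0, left_mem_Icc.2 zero_le_one, by simp [hg₁, apr_zero]⟩)
  · rw [hrange]
    rintro z ((hz | ⟨u, hu, rfl⟩) | hz)
    · exact Or.inl ⟨i', hmi.symm, hg₁im hz⟩
    · rcases hβpt u hu with h | h | h
      · exact Or.inl ⟨i', hmi.symm, h ▸ hP⟩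
      · exact Or.inl ⟨k', hmk.symm, h ▸ hQ⟩
      · exact Or.inr h
    · exact Or.inl ⟨k', hmk.symm, hg₂im hz⟩

/-- **Case I cannot occur**: two different gates cannot both meet the level set
`{‖ψ - c‖ = ε}` when `ψ(B₀) ⊆ B̄(c, η)`, `2^K η ≤ ε`, `K ≥ 400`. [cite: LawlerSchrammWerner2004, proof of Lemma 5.4] -/
theorem not_two_hits {η : ℝ} {K : ℕ} (hη : 0 < η) (hK : 400 ≤ K) (hKε : 2 ^ K * η ≤ ε)
    (hnear : ∀ z ∈ S.B₀, ‖S.ψ z - S.c‖ ≤ η) {i k : Fin 3} (hik : i ≠ k) {P Q : ℂ}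
    (hP : P ∈ S.gate i) (hPε : ‖S.ψ P - S.c‖ = ε) (hQ : Q ∈ S.gate k) (hQε : ‖S.ψ Q - S.c‖ = ε) :
    False := by
  obtain ⟨s, hs, hsP⟩ := S.exists_levelArc_eq hε0 hε1 hcε (S.gate_subset_Ω i hP) hPε
  obtain ⟨t, ht, htQ⟩ := S.exists_levelArc_eq hε0 hε1 hcε (S.gate_subset_Ω k hQ) hQε
  have hne : s ≠ t := by
    intro h
    have hPQ : P = Q := by rw [← hsP, ← htQ, h]
    have hx : P = S.x := S.gate_inter_gate_subset hik ⟨hP, hPQ ▸ hQ⟩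
    rw [hx, show S.ψ S.x = S.c from rfl, sub_self, norm_zero] at hPε
    exact hε0.ne' hPε.symm
  rcases lt_or_gt_of_ne hne with h | h
  · obtain ⟨m, J, hJ, hJΩ, hJx, hJG⟩ :=
      S.exists_caseI_loop hε0 hε1 hcε hik h hs ht (hsP ▸ hP) (htQ ▸ hQ)
    exact S.caseI_false hη hK hKε hnear m hJ hJΩ hJx hJG
  · obtain ⟨m, J, hJ, hJΩ, hJx, hJG⟩ :=
      S.exists_caseI_loop hε0 hε1 hcε hik.symm h ht hs (htQ ▸ hQ) (hsP ▸ hP)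
    exact S.caseI_false hη hK hKε hnear m hJ hJΩ hJx hJG

end CaseI

/-! ### The chamber lemma -/

/-- **The three-chamber lemma** (geometric core of [LSW04, Lemma 5.4]). In the configuration
`Setup` (domain `Ω = F(𝔻)` with inverse `ψ`, boundary point `0`, interior point `x = r + ai`
with `c = ψ x`, gate set `G = [0, x] ∪ ∂Q'`, launch regions `V_0, V_1, V_2` of the three
chambers), suppose the near ball `B₀ = B(x, 9r/10)` is conformally small, `ψ(B₀) ⊆ B̄(c, η)`,
with `2^K η ≤ ε < 1`, `K ≥ 400`, and `1 - ‖c‖ < ε`. Then there is a chamber index `m` such that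
every preconnected `T ⊆ Ω` avoiding `G` and meeting `V_m` is conformally `ε`-close to `x`:
`‖ψ z - c‖ < ε` for all `z ∈ T`. [cite: LawlerSchrammWerner2004, proof of Lemma 5.4] -/
theorem exists_near_chamber {ε η : ℝ} {K : ℕ} (hη : 0 < η) (hε1 : ε < 1) (hcε : 1 - ‖S.c‖ < ε)
    (hK : 400 ≤ K) (hKε : 2 ^ K * η ≤ ε) (hnear : ∀ z ∈ S.B₀, ‖S.ψ z - S.c‖ ≤ η) :
    ∃ m : Fin 3, ∀ T : Set ℂ, IsPreconnected T → T ⊆ S.Ω → Disjoint T S.G →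
      (T ∩ S.V m).Nonempty → ∀ z ∈ T, ‖S.ψ z - S.c‖ < ε := by
  have hε0 : 0 < ε := by
    have h1 : (0 : ℝ) < 2 ^ K * η := by positivity
    linarith
  -- a gate index off which no gate meets the level set
  obtain ⟨m, hm⟩ : ∃ m : Fin 3, ∀ i, i ≠ m → ∀ z ∈ S.gate i, ‖S.ψ z - S.c‖ ≠ ε := by
    by_cases h0 : ∃ i, ∃ z ∈ S.gate i, ‖S.ψ z - S.c‖ = ε
    · obtain ⟨i, P, hP, hPε⟩ := h0
      refine ⟨i, fun k hki Q hQ hQε ↦ ?_⟩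
      exact S.not_two_hits hε0 hε1 hcε hη hK hKε hnear (Ne.symm hki) hP hPε hQ hQε
    · push Not at h0
      exact ⟨0, fun i _ z hz ↦ h0 i z hz⟩
  obtain ⟨i, k, hik, him, hkm⟩ := exists_others m
  exact S.caseII hε0 hik him hkm (S.gate_near_of_forall_ne hε0 (hm i him))
    (S.gate_near_of_forall_ne hε0 (hm k hkm))

end Setup

end ThreeChamber

end Literature.Analysis.Complex
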